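import Literature.MathematicalPhysics.QuantumLattice.YangMillsSphericalSplit
import Literature.MathematicalPhysics.QuantumLattice.YangMillsStressEnergy
import Literature.MathematicalPhysics.QuantumLattice.LatticeWilsonFlow
import Literature.Analysis.Calculus.PlanarRotation
import Literature.Analysis.Calculus.SphereDivergence
import Literature.Analysis.Calculus.SphereSpectralShell
import HarnessLib

/-!
# Integration by parts on spheres for sections: `∮⟨φ, D_L D_L φ⟩ = −∮‖D_L φ‖²`

QuantumLattice support file (everything proved; no definitions, no named facts) on the proof
path of `Literature.MathematicalPhysics.QuantumLattice.Waldron2019_yangMillsFlow_flatTorus`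
(A. Waldron, Invent. math. 217 (2019)), §4 (the `f₁`-chain in the `u = ⋆(x ∧ F)` formalism):
for a `𝔲(m)`-valued `C¹` connection `A` on a finite-dimensional inner product space, a `C²`
matrix-valued section `φ`, an orthonormal frame `b`, indices `i, j` and `r > 0`,
`∮_{S_r} ⟨φ, D_{L_{ij}}(D_{L_{ij}} φ)⟩ = −∮_{S_r} ‖D_{L_{ij}} φ‖²`
(`sphereIntegral_inner_covDeriv_covDeriv_angular`): metric compatibility
(`fderiv_frobenius_inner_eq_covDeriv`) and `∮_{S_r} ∂_{L_{ij}} q = 0`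
(`sphereIntegral_fderiv_angular_eq_zero`). Summing over `i, j` turns the angular part of the
Casimir split into minus the angular energy, which the sharp Poincaré inequality controls.

References: A. Waldron, Invent. math. 217 (2019), §4.2 [Waldron2019]; [folklore].
-/

noncomputable section

open scoped RealInnerProductSpace Matrix.Norms.Frobenius
open Set MeasureTheory Metric
open Literature.Analysis.FluidPDE Literature.Analysis.Calculus

namespace Literature.MathematicalPhysics.QuantumLattice

attribute [local instance] frobeniusInnerProductSpace

variable {m : Type*} [Fintype m] [DecidableEq m]
variable {E : Type*} [NormedAddCommGroup E] [InnerProductSpace ℝ E] [FiniteDimensional ℝ E]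
  [MeasurableSpace E] [BorelSpace E]
variable {ι : Type*} [Fintype ι]

local notation "𝔤" => Matrix m m ℂ

omit [FiniteDimensional ℝ E] [MeasurableSpace E] [BorelSpace E] in
/-- `y ↦ D_{L(y)} φ(y)` is `C¹` for `φ ∈ C²`, `A ∈ C¹`. [folklore] -/
theorem contDiff_covDeriv_angular (b : OrthonormalBasis ι ℝ E) (i j : ι) {A : Connection E 𝔤}
    (hA : ContDiff ℝ 1 A) {φ : E → 𝔤} (hφ : ContDiff ℝ 2 φ) :
    ContDiff ℝ 1 fun y => covDeriv A φ y (angularField b i j y) := by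
  have hL : ContDiff ℝ 1 (fun y : E => angularField b i j y) := by
    rw [show (fun y : E => angularField b i j y) = fun y => ⟪y, b i⟫ • b j - ⟪y, b j⟫ • b i from
      funext fun y => angularField_apply b i j y]
    exact ((contDiff_id.inner ℝ contDiff_const).smul contDiff_const).sub
      ((contDiff_id.inner ℝ contDiff_const).smul contDiff_const)
  unfold covDeriv
  refine ContDiff.add ?_ ?_
  · exact (hφ.fderiv_right (m := 1) le_rfl).clm_apply hL
  · have hAL : ContDiff ℝ 1 fun y => A y (angularField b i j y) := hA.clm_apply hL
    have hφ1 : ContDiff ℝ 1 φ := hφ.of_le (by norm_num)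
    simp only [Ring.lie_def]
    exact (hAL.mul hφ1).sub (hφ1.mul hAL)

/-- **Integration by parts on the sphere for sections.** For a `𝔲(m)`-valued `C¹` connection,
a `C²` section `φ` and `r > 0`:
`∮_{S_r} ⟨φ, D_{L_{ij}}(D_{L_{ij}}φ)⟩ = −∮_{S_r} ‖D_{L_{ij}}φ‖²`. [folklore] -/
theorem sphereIntegral_inner_covDeriv_covDeriv_angular [Nontrivial E] (b : OrthonormalBasis ι ℝ E)
    (i j : ι) {A : Connection E 𝔤} (hA : ContDiff ℝ 1 A)
    (hval : A.IsValuedIn (skewAdjoint.submodule ℝ 𝔤)) {φ : E → 𝔤} (hφ : ContDiff ℝ 2 φ)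
    {r : ℝ} (hr : 0 < r) :
    sphereIntegral (volume : Measure E)
        (fun x => ⟪φ x, covDeriv A (fun y => covDeriv A φ y (angularField b i j y)) x (angularField b i j x)⟫) r =
      -sphereIntegral (volume : Measure E) (fun x => ‖covDeriv A φ x (angularField b i j x)‖ ^ 2) r := by
  set ψ : E → 𝔤 := fun y => covDeriv A φ y (angularField b i j y) with hψ_def
  have hψ1 : ContDiff ℝ 1 ψ := contDiff_covDeriv_angular b i j hA hφ
  have hφ1 : ContDiff ℝ 1 φ := hφ.of_le (by norm_num)
  have hφd : Differentiable ℝ φ := hφ1.differentiable (by simp)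
  have hψd : Differentiable ℝ ψ := hψ1.differentiable (by simp)
  -- the scalar `q = ⟨φ, ψ⟩`
  set q : E → ℝ := fun y => ⟪φ y, ψ y⟫ with hq_def
  have hq1 : ContDiff ℝ 1 q := hφ1.inner ℝ hψ1
  -- its angular derivative
  have hDq : ∀ x, fderiv ℝ q x (angularField b i j x) =
      ‖ψ x‖ ^ 2 + ⟪φ x, covDeriv A ψ x (angularField b i j x)⟫ := by
    intro x
    rw [hq_def, fderiv_frobenius_inner_eq_covDeriv (hφd x) (hψd x) _ (hval x _), ← real_inner_self_eq_norm_sq]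
  -- `∮ ∂_L q = 0`
  by_cases hij : i = j
  · -- `L_{ii} = 0`: both sides vanish
    subst hij
    have hL0 : ∀ x : E, angularField b i i x = 0 := fun x => by rw [angularField_apply, sub_self]
    have h1 : (fun x => ⟪φ x, covDeriv A (fun y => covDeriv A φ y (angularField b i i y)) x (angularField b i i x)⟫) =
        fun _ => (0 : ℝ) := by
      funext x; rw [hL0 x]; simp [covDeriv, Ring.lie_def]
    have h2 : (fun x => ‖covDeriv A φ x (angularField b i i x)‖ ^ 2) = fun _ => (0 : ℝ) := by
      funext x; rw [hL0 x]; simp [covDeriv, Ring.lie_def]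
    rw [h1, h2]
    simp [sphereIntegral_def]
  · have hbi : ‖b i‖ = 1 := b.orthonormal.1 i
    have hbj : ‖b j‖ = 1 := b.orthonormal.1 j
    have hbij : ⟪b i, b j⟫ = 0 := b.orthonormal.2 hij
    have h0 := sphereIntegral_fderiv_angular_eq_zero hbi hbj hbij hq1.contDiffOn hr
    have heq : (fun x => fderiv ℝ q x (⟪x, b i⟫ • b j - ⟪x, b j⟫ • b i)) =
        fun x => ‖ψ x‖ ^ 2 + ⟪φ x, covDeriv A ψ x (angularField b i j x)⟫ := by
      funext x; rw [← angularField_apply, hDq x]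
    rw [heq, sphereIntegral_add_of (fun x => ‖ψ x‖ ^ 2) (fun x => ⟪φ x, covDeriv A ψ x (angularField b i j x)⟫)
      ((hψ1.continuous.norm.pow 2).continuousOn) ?_ hr] at h0
    · linarith
    · have hDψ : Continuous fun x => covDeriv A ψ x (angularField b i j x) := by
        unfold covDeriv
        have hL : Continuous fun y : E => angularField b i j y := continuous_angularField b i j
        refine Continuous.add ?_ ?_
        · exact (hψ1.continuous_fderiv one_ne_zero).clm_apply hL
        · simp only [Ring.lie_def]
          have hAL : Continuous fun y => A y (angularField b i j y) := hA.continuous.clm_apply hL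
          exact (hAL.mul hψ1.continuous).sub (hψ1.continuous.mul hAL)
      exact (hφ1.continuous.inner hDψ).continuousOn

end Literature.MathematicalPhysics.QuantumLattice
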